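import Summits.Parity.GeneralizedHardyLittlewood.Theorems.PrimeLevelFamEdgeMomentsBeyondDiagonalFirstOrderDiagExpansion
import HarnessLib

/-!
# The leading coefficient of the order-`k` diagonal: `Σ_c Σ_b p_c (i choose b)(−θ)^{i−b}(b + c) = P′(1)(1−θ)^i + i P(1)(1−θ)^{i−1}`
# (helper for crux K_A `PrimeLevelFamEdge.MomentsBeyondDiagonal`, stmt-Parity-20007, stub `stub_first : SubFirst` ∀`Q`)

After `diagSum_expand` (`…FirstOrderDiagExpansion`) and `W_j(M) = ζ(2) j log^{j−1}M + O(log^{j−2}M)`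
(`MollifierMainTerm.abs_weightLogPowSum_sub_le`), the coefficient of `ζ(2) (log M)^{i−1}` in the `i`-th diagonal sum
`Σ_m μ(m)ψ(m)⁻¹m⁻¹ P(log(M/m)/log M)(log(M/m) − θ log M)^i` is the double sum evaluated here; with `θ = (Δ'−1)/Δ'`
(`1 − θ = 1/Δ'`) and `(log M)^{i−1} = Δ'^{i−1}ℓ^{i−1}` it is `ℓ^{i−1}(P′(1)/Δ' + i P(1))`, i.e. KMV's `Q(1)P′(1) + ΔQ′(1)P(1)` at
`Q = Y^i` after the `ℓ^{−i}` normalisation. Pure algebra (`add_pow`, `sum_range_mul_choose_pow_eq`).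
Proof only; nothing about Landau–Siegel zeros; K_A NOT proved.
-/

noncomputable section

open Finset Polynomial

namespace Summit.Parity.GeneralizedHardyLittlewood.Theorems.MomentsBeyondDiagonal.FirstOrderAFE

/-- **Leading coefficient identity**: for a real polynomial `P`, real `θ` and `i`,
`Σ_{c ≤ deg P} Σ_{b ≤ i} P_c (i choose b)(−θ)^{i−b}(b + c) = P′(1)(1−θ)^i + i·P(1)·(1−θ)^{i−1}`.
[cite: KowalskiMichelVanderKam2000, §4.1 (20) and §6 (30)] -/
theorem sum_coeff_choose_mul_add_eq (P : ℝ[X]) (θ : ℝ) (i : ℕ) :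
    ∑ c ∈ range (P.natDegree + 1), ∑ b ∈ range (i + 1),
        P.coeff c * ((i.choose b : ℕ) : ℝ) * (-θ) ^ (i - b) * ((b : ℝ) + c) =
      (derivative P).eval 1 * (1 - θ) ^ i + (i : ℝ) * P.eval 1 * (1 - θ) ^ (i - 1) := by
  -- the two binomial sums
  have h1 : ∑ b ∈ range (i + 1), ((i.choose b : ℕ) : ℝ) * (-θ) ^ (i - b) = (1 - θ) ^ i := by
    rw [sub_eq_add_neg, add_pow]
    refine Finset.sum_congr rfl fun b _ ↦ ?_
    rw [one_pow, one_mul, mul_comm]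
  have h2 : ∑ b ∈ range (i + 1), (b : ℝ) * ((i.choose b : ℕ) : ℝ) * (-θ) ^ (i - b) = (i : ℝ) * (1 - θ) ^ (i - 1) := by
    have h := sum_range_mul_choose_pow_eq 1 (-θ) i
    simp only [one_pow, mul_one] at h
    rw [sub_eq_add_neg, ← h]
  -- `P(1) = Σ_c P_c`, `P′(1) = Σ_c c P_c`
  have hP1 : P.eval 1 = ∑ c ∈ range (P.natDegree + 1), P.coeff c := by
    rw [Polynomial.eval_eq_sum_range]; simp
  have hP'1 : (derivative P).eval 1 = ∑ c ∈ range (P.natDegree + 1), P.coeff c * (c : ℝ) := by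
    rw [Polynomial.derivative_eval, Polynomial.sum_over_range' _ _ (P.natDegree + 1) (Nat.lt_succ_self _)]
    · simp
    · intro n; simp
  -- split `(b + c)` and factor
  have hsplit : ∀ c ∈ range (P.natDegree + 1),
      ∑ b ∈ range (i + 1), P.coeff c * ((i.choose b : ℕ) : ℝ) * (-θ) ^ (i - b) * ((b : ℝ) + c) =
        P.coeff c * (c : ℝ) * (1 - θ) ^ i + P.coeff c * ((i : ℝ) * (1 - θ) ^ (i - 1)) := by
    intro c _
    rw [← h1, ← h2, Finset.mul_sum, Finset.mul_sum, ← Finset.sum_add_distrib]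
    refine Finset.sum_congr rfl fun b _ ↦ ?_
    ring
  rw [Finset.sum_congr rfl hsplit, Finset.sum_add_distrib, ← Finset.sum_mul, ← Finset.sum_mul, hP1, hP'1]
  ring

end Summit.Parity.GeneralizedHardyLittlewood.Theorems.MomentsBeyondDiagonal.FirstOrderAFE

end
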